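/-
Copyright (c) 2026. Released under the Apache 2.0 license.
-/
import Literature.NumberTheory.EllipticCurves.LatticeInclusionDescentProofs
import Literature.NumberTheory.EllipticCurves.LatticeInclusionRigidityProofs
import Literature.NumberTheory.EllipticCurves.WeierstrassAdditionProofs
import Literature.NumberTheory.EllipticCurves.ComplexTorus
import Literature.NumberTheory.EllipticCurves.RealLatticePeriodDiscrProofs
import HarnessLib

/-!
# Index-two superlattices with rational invariants: the half-period is a rational `2`-torsion
# abscissa, and the superlattice is the Vélu lattice of that `2`-torsion point

Topic `NumberTheory/EllipticCurves`; a proofs-only file (theorems only: no definitions, no named facts) in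
`namespace PeriodPair` (deliberate dot-notation extensions of Mathlib's `PeriodPair`, as in the sibling files
`LatticeInclusionDescentProofs.lean`, `LatticeInclusionRigidityProofs.lean`).

For lattices `Λ ⊆ Λ'` of INDEX `2` — `Λ' = Λ + ℤ z₀` with `2 z₀ ∈ Λ`, `z₀ ∉ Λ` — the isogeny `ℂ/Λ → ℂ/Λ'`, `z ↦ z`,
is the `2`-isogeny with kernel the `2`-torsion point `z₀ + Λ` (Silverman, *AEC*, III.4.5 and Thm. VI.4.1).  Proved here:

* (private) a half-period `z₀` has `℘′(z₀) = 0` (tree: `derivWeierstrassP_eq_zero_of_two_mul_mem`), so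
  `x₀ = ℘(z₀)` is a root of `4x³ − g₂x − g₃` (tree: `Literature.NumberTheory.Transcendental.cubic_weierstrassP_eq_zero`);
* `exists_ratCast_eq_weierstrassP_of_index_two` — **if `g₂, g₃, g₂′, g₃′ ∈ ℚ` then `℘_Λ(z₀) ∈ ℚ`**: the
  `2`-torsion point generating the kernel of a `2`-isogeny between curves over `ℚ` (in Weierstrass `℘`-coordinates) is
  RATIONAL.  Proof: by `exists_rat_polynomial_weierstrassP_mul_eval_eq_of_le` (Cox §10.C descent, tree)
  `℘_{Λ'}·Q₀(℘_Λ) = P₀(℘_Λ)` with `P₀, Q₀ ∈ ℚ[X]`, `Q₀` monic and `Q₀(℘_Λ) ≠ 0` off `Λ'`; the pole of `℘_{Λ'}` at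
  `z₀` forces `Q₀(x₀) = 0`, and every complex root `r = ℘_Λ(z)` of `Q₀` has `z ∈ Λ' ∖ Λ = ±z₀ + Λ`, so `r = x₀`:
  `Q₀ = (X − x₀)^m`, `m ≥ 1`, whence `m x₀ = −(next coefficient) ∈ ℚ`;
* `lattice_eq_of_velu_invariants` — **Vélu on the analytic side**: if `2z₀ ∈ Λ`, `z₀ ∉ Λ`, `x₀ = ℘_Λ(z₀)`,
  `B = 3x₀² − g₂/4` and a lattice `Λ''` has invariants `g₂″ = 12x₀² + 16B`, `g₃″ = −8x₀³ + 32Bx₀` (the invariants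
  of Vélu's curve `Y² = X³ − 2A X² + (A² − 4B)X`, `A = 3x₀`, for `y² = x(x² + Ax + B)` = the curve `ℂ/Λ` with the
  `2`-torsion point moved to `(0,0)`), then `Λ'' = Λ + ℤz₀`: `Λ ⊆ Λ''`, `z₀ ∈ Λ''`, and every `w ∈ Λ''` lies in
  `Λ ∪ (z₀ + Λ)`.  Proof: the transformation `T = (X² − x₀X + B)/(X − x₀)` satisfies the algebraic certificate
  `(T′)²·Q⁴-form (P′Q − PQ′)²(4X³ − g₂X − g₃) = Q(4P³ − g₂″PQ² − g₃″Q³)` (a polynomial identity modulo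
  `4x₀³ − g₂x₀ − g₃ = 0`), so `Λ ⊆ Λ''` and `T(℘_Λ z) = ℘_{Λ''}(z)` (tree:
  `lattice_le_of_transformation_polynomial_identity`, `exists_eq_weierstrassP_comp_of_transformation_polynomial_identity`,
  `const_mem_lattice_of_eq_weierstrassP_comp`); the poles of `℘_{Λ''}` are then exactly where `℘_Λ = x₀` or
  `℘_Λ = ∞`, i.e. on `±z₀ + Λ` and `Λ` (`weierstrassP_eq_weierstrassP_iff`).

## References
* J. H. Silverman, *The Arithmetic of Elliptic Curves*, 2nd ed., GTM 106: III.4 Example 4.5 (the `2`-isogeny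
  `y² = x³ + ax² + bx → Y² = X³ − 2aX² + (a² − 4b)X`), Thm. VI.4.1. [SilvermanAEC2009]
* D. A. Cox, *Primes of the form x² + ny²*, 2nd ed.: §10.C. [Cox2013]
* D. F. Lawden, *Elliptic Functions and Applications*: §9.8 (transformation of `℘` under a lattice inclusion).
  [Lawden1989]
-/

noncomputable section

open Complex Set Polynomial Filter Topology Bornology
open Literature.NumberTheory.EllipticCurves

namespace PeriodPair

variable (L L' : PeriodPair)

/-! ### Half-periods are `2`-torsion abscissae -/

/-- A half-period value `x₀ = ℘_Λ(z₀)` is a root of `4x³ − g₂x − g₃` (`℘′(z₀)² = 0`); private copy of the tree's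
`Literature.NumberTheory.Transcendental.cubic_weierstrassP_eq_zero` (whose module is not imported here to keep the
import cone arithmetic). [cite: SilvermanAEC2009, III.4 Example 4.5] -/
private theorem four_mul_weierstrassP_pow_three_sub_eq_zero_of_two_mul_mem {z₀ : ℂ} (hz₀ : z₀ ∉ L.lattice)
    (h2 : 2 * z₀ ∈ L.lattice) : 4 * ℘[L] z₀ ^ 3 - L.g₂ * ℘[L] z₀ - L.g₃ = 0 := by
  rw [← L.derivWeierstrassP_sq z₀ hz₀, L.derivWeierstrassP_eq_zero_of_two_mul_mem h2]
  ring

/-! ### Index two: the `℘`-value of the half-period is rational -/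

/-- Off `Λ`, near a point `w ∈ Λ' ∖ Λ` the points of `𝓝[≠] w` are eventually outside `Λ'` and outside `Λ`. [folklore] -/
private theorem eventually_nhdsNE_notMem {w : ℂ} (hw : w ∉ L.lattice) :
    ∀ᶠ z in 𝓝[≠] w, z ∉ L'.lattice ∧ z ∉ L.lattice := by
  have h1 : ∀ᶠ z in 𝓝[≠] w, z ∉ L'.lattice := by
    have h := L'.compl_lattice_sdiff_singleton_mem_nhds w
    have h' : ∀ᶠ z in 𝓝 w, z ∈ (↑L'.lattice \ {w} : Set ℂ)ᶜ := h
    filter_upwards [nhdsWithin_le_nhds h', self_mem_nhdsWithin] with z hz hne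
    intro hzΛ
    exact hz ⟨hzΛ, hne⟩
  have h2 : ∀ᶠ z in 𝓝[≠] w, z ∉ L.lattice := by
    have hopen : IsOpen ((L.lattice : Set ℂ)ᶜ) := L.isClosed_lattice.isOpen_compl
    exact nhdsWithin_le_nhds (hopen.mem_nhds hw)
  exact h1.and h2

/-- **The denominator of the transformation vanishes at the new poles.** If `℘_{Λ'}·Q(℘_Λ) = P(℘_Λ)` off `Λ'` and
`w ∈ Λ' ∖ Λ`, then `Q(℘_Λ(w)) = 0`: otherwise `℘_{Λ'} = (P/Q)(℘_Λ)` would have a finite limit at its pole `w`.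
[cite: SilvermanAEC2009, Thm. VI.4.1] -/
theorem eval_weierstrassP_eq_zero_of_mem_of_notMem {P Q : ℂ[X]}
    (hPQ : ∀ z ∉ L'.lattice, z ∉ L.lattice → Q.eval (℘[L] z) ≠ 0 →
      ℘[L'] z * Q.eval (℘[L] z) = P.eval (℘[L] z))
    {w : ℂ} (hw' : w ∈ L'.lattice) (hw : w ∉ L.lattice) : Q.eval (℘[L] w) = 0 := by
  by_contra hQ
  have hcont : ContinuousAt ℘[L] w := (L.analyticOnNhd_weierstrassP w hw).continuousAt
  have hlim : Tendsto (fun z ↦ P.eval (℘[L] z) / Q.eval (℘[L] z)) (𝓝[≠] w)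
      (𝓝 (P.eval (℘[L] w) / Q.eval (℘[L] w))) := by
    have hP : ContinuousAt (fun z ↦ P.eval (℘[L] z)) w := P.continuous.continuousAt.comp hcont
    have hQc : ContinuousAt (fun z ↦ Q.eval (℘[L] z)) w := Q.continuous.continuousAt.comp hcont
    exact ((hP.div hQc hQ).tendsto).mono_left nhdsWithin_le_nhds
  have h5 : Tendsto ℘[L'] (𝓝[≠] w) (𝓝 (P.eval (℘[L] w) / Q.eval (℘[L] w))) := by
    refine hlim.congr' ?_
    have hQev : ∀ᶠ z in 𝓝[≠] w, Q.eval (℘[L] z) ≠ 0 := by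
      have hQc : ContinuousAt (fun z ↦ Q.eval (℘[L] z)) w := Q.continuous.continuousAt.comp hcont
      exact nhdsWithin_le_nhds (hQc.eventually_ne hQ)
    filter_upwards [L.eventually_nhdsNE_notMem L' hw, hQev] with z hz hQz
    rw [← hPQ z hz.1 hz.2 hQz, mul_div_cancel_right₀ _ hQz]
  have h6 : Tendsto (fun z ↦ ‖℘[L'] z‖) (𝓝[≠] w) atTop :=
    tendsto_norm_cobounded_atTop.comp (L'.tendsto_weierstrassP_cobounded hw')
  exact h5.norm.not_tendsto (disjoint_nhds_atTop _) h6

/-- **The kernel of a rational `2`-isogeny is a rational `2`-torsion point (analytic form).**  Let `Λ ⊆ Λ'` be period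
lattices of index `2` — `z₀ ∈ Λ' ∖ Λ` and every `w ∈ Λ'` lies in `Λ` or in `z₀ + Λ` — whose invariants
`g₂, g₃, g₂′, g₃′` are rational.  Then `℘_Λ(z₀) ∈ ℚ`.  (So the elliptic curve `y² = 4x³ − g₂x − g₃` over `ℚ` has the
RATIONAL `2`-torsion point `(℘_Λ(z₀), 0)`, the generator of the kernel of `ℂ/Λ → ℂ/Λ'`.)
[cite: SilvermanAEC2009, Thm. VI.4.1 and III.4 Example 4.5] [cite: Cox2013, §10.C proof of Thm. 10.23] -/
theorem exists_ratCast_eq_weierstrassP_of_index_two (h : L.lattice ≤ L'.lattice)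
    (h₂ : ∃ q : ℚ, (q : ℂ) = L.g₂) (h₃ : ∃ q : ℚ, (q : ℂ) = L.g₃)
    (h₂' : ∃ q : ℚ, (q : ℂ) = L'.g₂) (h₃' : ∃ q : ℚ, (q : ℂ) = L'.g₃)
    {z₀ : ℂ} (hz₀' : z₀ ∈ L'.lattice) (hz₀ : z₀ ∉ L.lattice)
    (hidx : ∀ w ∈ L'.lattice, w ∈ L.lattice ∨ w - z₀ ∈ L.lattice) :
    ∃ q : ℚ, (q : ℂ) = ℘[L] z₀ := by
  classical
  obtain ⟨P₀, Q₀, hQ₀m, -, hQ, hPQ⟩ := L.exists_rat_polynomial_weierstrassP_mul_eval_eq_of_le L' h h₂ h₃ h₂' h₃'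
  set x₀ := ℘[L] z₀ with hx₀
  set Qc : ℂ[X] := Q₀.map (algebraMap ℚ ℂ) with hQc
  have hQcm : Qc.Monic := hQ₀m.map _
  have hQc0 : Qc ≠ 0 := hQcm.ne_zero
  -- `Q₀(x₀) = 0`
  have hroot : Qc.eval x₀ = 0 :=
    L.eval_weierstrassP_eq_zero_of_mem_of_notMem L' (fun z hz _ _ ↦ hPQ z hz) hz₀' hz₀
  -- every root of `Q₀` is `x₀`
  have hall : ∀ r ∈ Qc.roots, r = x₀ := by
    intro r hr
    have hr' : Qc.eval r = 0 := (mem_roots hQc0).mp hr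
    obtain ⟨z, hz, hzr⟩ := L.exists_weierstrassP_eq r
    have hzΛ' : z ∈ L'.lattice := by
      by_contra hz'
      exact hQ z hz' (by rw [hzr]; exact hr')
    rcases hidx z hzΛ' with hzΛ | hzΛ
    · exact absurd hzΛ hz
    · rw [← hzr]
      have := L.weierstrassP_sub_coe z ⟨z - z₀, hzΛ⟩
      rw [show z - (z - z₀) = z₀ by ring] at this
      exact this.symm
  -- `Q₀ = (X − x₀)^m`, so `m • x₀ = −nextCoeff ∈ ℚ`
  have hsplit : Splits Qc := IsAlgClosed.splits Qc
  have hroots : Qc.roots = Multiset.replicate Qc.natDegree x₀ := by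
    rw [hsplit.natDegree_eq_card_roots]
    exact Multiset.eq_replicate_card.mpr hall
  have hm : 0 < Qc.natDegree := by
    have hmem : x₀ ∈ Qc.roots := (mem_roots hQc0).mpr hroot
    rw [hsplit.natDegree_eq_card_roots]
    exact Multiset.card_pos.mpr fun h0 ↦ Multiset.notMem_zero x₀ (h0 ▸ hmem)
  have hnext : Qc.nextCoeff = -(Qc.natDegree : ℂ) * x₀ := by
    rw [hsplit.nextCoeff_eq_neg_sum_roots_of_monic hQcm, hroots, Multiset.sum_replicate, nsmul_eq_mul]
    ring
  have hnextQ : Qc.nextCoeff = ((Q₀.nextCoeff : ℚ) : ℂ) := by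
    rw [hQc, nextCoeff_map_eq]; rfl
  have hdeg : Qc.natDegree = Q₀.natDegree := by rw [hQc, natDegree_map]
  refine ⟨-Q₀.nextCoeff / Q₀.natDegree, ?_⟩
  have hm' : (Q₀.natDegree : ℂ) ≠ 0 := by rw [← hdeg]; exact_mod_cast hm.ne'
  push_cast
  rw [← hnextQ, hnext, hdeg]
  field_simp

/-! ### Vélu on the analytic side: the superlattice with Vélu's invariants is `Λ + ℤ z₀` -/

/-- **The algebraic certificate of the `2`-isogeny transformation.**  With `x₀` a root of `4x³ − g₂x − g₃`,
`B = 3x₀² − g₂/4`, `P = X² − x₀X + B`, `Q = X − x₀` and the Vélu invariants `g₂″ = 12x₀² + 16B`,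
`g₃″ = −8x₀³ + 32Bx₀`: `(P′Q − PQ′)²(4X³ − g₂X − g₃) = Q(4P³ − g₂″PQ² − g₃″Q³)` — a polynomial identity.
[cite: SilvermanAEC2009, III.4 Example 4.5] [cite: Lawden1989, §9.8] -/
theorem velu_two_transformation_polynomial_identity {x₀ g₂ g₃ g₂'' g₃'' B : ℂ}
    (hx₀ : 4 * x₀ ^ 3 - g₂ * x₀ - g₃ = 0) (hB : B = 3 * x₀ ^ 2 - g₂ / 4)
    (h₂ : g₂'' = 12 * x₀ ^ 2 + 16 * B) (h₃ : g₃'' = -8 * x₀ ^ 3 + 32 * B * x₀) :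
    (derivative (X ^ 2 - C x₀ * X + C B) * (X - C x₀) - (X ^ 2 - C x₀ * X + C B) * derivative (X - C x₀)) ^ 2 *
        (4 * X ^ 3 - C g₂ * X - C g₃) =
      (X - C x₀) * (4 * (X ^ 2 - C x₀ * X + C B) ^ 3 - C g₂'' * (X ^ 2 - C x₀ * X + C B) * (X - C x₀) ^ 2 -
        C g₃'' * (X - C x₀) ^ 3) := by
  have hg₂ : g₂ = 12 * x₀ ^ 2 - 4 * B := by linear_combination 4 * hB
  have hg₃ : g₃ = -8 * x₀ ^ 3 + 4 * B * x₀ := by linear_combination -hx₀ - x₀ * hg₂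
  have hd1 : derivative (X ^ 2 - C x₀ * X + C B : ℂ[X]) = C 2 * X - C x₀ := by
    rw [derivative_add, derivative_sub, derivative_X_sq, derivative_C_mul, derivative_X, derivative_C, mul_one,
      add_zero]
  have hd2 : derivative (X - C x₀ : ℂ[X]) = 1 := by
    rw [derivative_sub, derivative_X, derivative_C, sub_zero]
  rw [h₂, h₃, hg₃, hg₂, hd1, hd2]
  simp only [map_add, map_sub, map_mul, map_pow, map_neg, map_ofNat]
  ring

/-- **Vélu's lattice.**  Let `z₀` be a half-period of `Λ` (`z₀ ∉ Λ`, `2z₀ ∈ Λ`), `x₀ = ℘_Λ(z₀)`, `B = 3x₀² − g₂/4`,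
and let `Λ''` be any period lattice with the VÉLU INVARIANTS `g₂″ = 12x₀² + 16B`, `g₃″ = −8x₀³ + 32Bx₀` (those of
`Y² = X³ − 2AX² + (A² − 4B)X`, `A = 3x₀`, the quotient of `ℂ/Λ : y² = x(x² + Ax + B)` by its `2`-torsion point
`(0,0) ↔ z₀`).  Then `Λ'' = Λ + ℤz₀`: `Λ ⊆ Λ''`, `z₀ ∈ Λ''`, and every `w ∈ Λ''` lies in `Λ` or in `z₀ + Λ`.
Proof: the certificate (`velu_two_transformation_polynomial_identity`) gives `Λ ⊆ Λ''` and
`℘_{Λ''}(εz + c) = T(℘_Λ z)`, `T = (X² − x₀X + B)/(X − x₀)`, with `c ∈ Λ''` (`deg Q < deg P`), hence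
`℘_{Λ''} = T(℘_Λ)` off `Λ ∪ Λ''`; `T(℘_Λ z) → ∞` as `z → z₀` (`P(x₀) = B ≠ 0`), so `z₀` is a pole of `℘_{Λ''}`; and a
pole `w ∉ Λ` of `℘_{Λ''}` has `Q(℘_Λ(w)) = 0`, i.e. `℘_Λ(w) = ℘_Λ(z₀)`, i.e. `w ∈ ±z₀ + Λ = z₀ + Λ`.
[cite: SilvermanAEC2009, III.4 Example 4.5 and Thm. VI.4.1] [cite: Lawden1989, §9.8] -/
theorem lattice_eq_of_velu_invariants {z₀ : ℂ} (hz₀ : z₀ ∉ L.lattice) (h2 : 2 * z₀ ∈ L.lattice) {B : ℂ}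
    (hB : B = 3 * ℘[L] z₀ ^ 2 - L.g₂ / 4) (hB0 : B ≠ 0)
    (L'' : PeriodPair) (h₂ : L''.g₂ = 12 * ℘[L] z₀ ^ 2 + 16 * B)
    (h₃ : L''.g₃ = -8 * ℘[L] z₀ ^ 3 + 32 * B * ℘[L] z₀) :
    L.lattice ≤ L''.lattice ∧ z₀ ∈ L''.lattice ∧ ∀ w ∈ L''.lattice, w ∈ L.lattice ∨ w - z₀ ∈ L.lattice := by
  classical
  set x₀ := ℘[L] z₀ with hx₀
  set P : ℂ[X] := X ^ 2 - C x₀ * X + C B with hP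
  set Q : ℂ[X] := X - C x₀ with hQ
  have hQ0 : Q ≠ 0 := X_sub_C_ne_zero x₀
  have hQdeg : Q.natDegree = 1 := natDegree_X_sub_C x₀
  have hPdeg : P.natDegree = 2 := by
    rw [hP]; compute_degree!
  have hnc : ∀ k : ℂ, P ≠ C k * Q := by
    intro k hk
    have h := congrArg natDegree hk
    rw [hPdeg] at h
    by_cases hk0 : k = 0
    · rw [hk0, map_zero, zero_mul, natDegree_zero] at h; exact absurd h (by norm_num)
    · rw [natDegree_C_mul hk0, hQdeg] at h; exact absurd h (by norm_num)
  have hid : (derivative P * Q - P * derivative Q) ^ 2 * (4 * X ^ 3 - C L.g₂ * X - C L.g₃) =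
      Q * (4 * P ^ 3 - C L''.g₂ * P * Q ^ 2 - C L''.g₃ * Q ^ 3) :=
    velu_two_transformation_polynomial_identity
      (L.four_mul_weierstrassP_pow_three_sub_eq_zero_of_two_mul_mem hz₀ h2) hB h₂ h₃
  -- (1) `Λ ⊆ Λ''`
  have hle : L.lattice ≤ L''.lattice := L.lattice_le_of_transformation_polynomial_identity L'' hQ0 hnc hid
  -- (2) `T(℘_Λ z) = ℘_{Λ''}(z)` off `Λ ∪ Λ''` where `Q(℘_Λ z) ≠ 0`
  obtain ⟨ε, hε, c, hc⟩ := L.exists_eq_weierstrassP_comp_of_transformation_polynomial_identity L'' hQ0 hnc hid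
  have hcmem : c ∈ L''.lattice :=
    L.const_mem_lattice_of_eq_weierstrassP_comp L'' hQ0 (by rw [hQdeg, hPdeg]; norm_num) hc
  have h℘'' : ∀ z : ℂ, ℘[L''] (ε * z + c) = ℘[L''] z := by
    intro z
    rw [L''.weierstrassP_add_coe (ε * z) ⟨c, hcmem⟩]
    rcases hε with rfl | rfl
    · rw [one_mul]
    · rw [neg_one_mul, L''.weierstrassP_neg]
  have hεc : ∀ z : ℂ, z ∉ L''.lattice → ε * z + c ∉ L''.lattice := by
    intro z hz h
    apply hz
    have h1 : ε * z ∈ L''.lattice := by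
      have := sub_mem h hcmem
      rwa [add_sub_cancel_right] at this
    rcases hε with rfl | rfl
    · rwa [one_mul] at h1
    · rw [neg_one_mul] at h1
      simpa using neg_mem h1
  have hmul : ∀ z ∉ L''.lattice, z ∉ L.lattice → Q.eval (℘[L] z) ≠ 0 →
      ℘[L''] z * Q.eval (℘[L] z) = P.eval (℘[L] z) := by
    intro z hz'' hz hQz
    rw [← h℘'' z, ← hc z hz hQz (hεc z hz''), div_mul_cancel₀ _ hQz]
  -- (3) every `w ∈ Λ'' ∖ Λ` lies in `z₀ + Λ`
  have key : ∀ w ∈ L''.lattice, w ∈ L.lattice ∨ w - z₀ ∈ L.lattice := by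
    intro w hw''
    by_cases hw : w ∈ L.lattice
    · exact Or.inl hw
    right
    have hQw : Q.eval (℘[L] w) = 0 := L.eval_weierstrassP_eq_zero_of_mem_of_notMem L'' hmul hw'' hw
    have hw℘ : ℘[L] w = ℘[L] z₀ := by simpa [hQ, sub_eq_zero] using hQw
    rcases (L.weierstrassP_eq_weierstrassP_iff hw hz₀).mp hw℘ with hs | hs
    · have e : w - z₀ = (w + z₀) - 2 * z₀ := by ring
      rw [e]
      exact sub_mem hs h2
    · exact hs
  -- (4) `Λ'' ≠ Λ` (else `T = id`, `B = 0`), so some `w ∈ Λ'' ∖ Λ` exists and `z₀ = w − (w − z₀) ∈ Λ''`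
  have hne : ∃ w ∈ L''.lattice, w ∉ L.lattice := by
    by_contra! hall
    have hΛ : L.lattice = L''.lattice := le_antisymm hle fun w hw ↦ hall w hw
    obtain ⟨z, hz, hzx⟩ := L.exists_weierstrassP_eq (x₀ + 1)
    have hQz : Q.eval (℘[L] z) ≠ 0 := by simp [hQ, hzx]
    have hz'' : z ∉ L''.lattice := fun h ↦ hz (hall z h)
    have hT := hc z hz hQz (hεc z hz'')
    rw [h℘'' z, ← PeriodPair.weierstrassP_eq_of_lattice_eq hΛ, hzx] at hT
    have hP1 : P.eval (x₀ + 1) = x₀ + 1 + B := by simp [hP]; ring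
    have hQ1 : Q.eval (x₀ + 1) = 1 := by simp [hQ]
    rw [hP1, hQ1, div_one] at hT
    exact hB0 (by linear_combination hT)
  obtain ⟨w, hw'', hw⟩ := hne
  have hz₀'' : z₀ ∈ L''.lattice := by
    rcases key w hw'' with h | h
    · exact absurd h hw
    · have e : z₀ = w - (w - z₀) := by ring
      rw [e]
      exact sub_mem hw'' (hle h)
  exact ⟨hle, hz₀'', key⟩

/-! ### Cyclic kernels in general: one `℘`-value on `Λ' ∖ Λ` (index `2` and index `3`) -/

/-- **General form of the rationality of the kernel abscissa.**  Let `Λ ⊆ Λ'` be period lattices with rational invariants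
`g₂, g₃, g₂′, g₃′`, and `z₀ ∈ Λ' ∖ Λ` such that `℘_Λ` takes the single value `℘_Λ(z₀)` on `Λ' ∖ Λ` (e.g. `Λ' = Λ + ℤz₀` of
index `2`, or of index `3`: `Λ' ∖ Λ = ±z₀ + Λ` and `℘_Λ` is even).  Then `℘_Λ(z₀) ∈ ℚ` — the `x`-coordinate (in Weierstrass
normal form) of a generator of the cyclic kernel of the isogeny `ℂ/Λ → ℂ/Λ'` is rational.  Same proof as
`exists_ratCast_eq_weierstrassP_of_index_two`: the denominator `Q₀ ∈ ℚ[X]` of the descended transformation is a power of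
`X − ℘_Λ(z₀)`. [cite: SilvermanAEC2009, Thm. VI.4.1 and III.4 (kernel polynomial of a cyclic isogeny)]
[cite: Cox2013, §10.C proof of Thm. 10.23] -/
theorem exists_ratCast_eq_weierstrassP_of_forall_weierstrassP_eq (h : L.lattice ≤ L'.lattice)
    (h₂ : ∃ q : ℚ, (q : ℂ) = L.g₂) (h₃ : ∃ q : ℚ, (q : ℂ) = L.g₃)
    (h₂' : ∃ q : ℚ, (q : ℂ) = L'.g₂) (h₃' : ∃ q : ℚ, (q : ℂ) = L'.g₃)
    {z₀ : ℂ} (hz₀' : z₀ ∈ L'.lattice) (hz₀ : z₀ ∉ L.lattice)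
    (hval : ∀ w ∈ L'.lattice, w ∉ L.lattice → ℘[L] w = ℘[L] z₀) :
    ∃ q : ℚ, (q : ℂ) = ℘[L] z₀ := by
  classical
  obtain ⟨P₀, Q₀, hQ₀m, -, hQ, hPQ⟩ := L.exists_rat_polynomial_weierstrassP_mul_eval_eq_of_le L' h h₂ h₃ h₂' h₃'
  set x₀ := ℘[L] z₀ with hx₀
  set Qc : ℂ[X] := Q₀.map (algebraMap ℚ ℂ) with hQc
  have hQcm : Qc.Monic := hQ₀m.map _
  have hQc0 : Qc ≠ 0 := hQcm.ne_zero
  have hroot : Qc.eval x₀ = 0 :=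
    L.eval_weierstrassP_eq_zero_of_mem_of_notMem L' (fun z hz _ _ ↦ hPQ z hz) hz₀' hz₀
  have hall : ∀ r ∈ Qc.roots, r = x₀ := by
    intro r hr
    have hr' : Qc.eval r = 0 := (mem_roots hQc0).mp hr
    obtain ⟨z, hz, hzr⟩ := L.exists_weierstrassP_eq r
    have hzΛ' : z ∈ L'.lattice := by
      by_contra hz'
      exact hQ z hz' (by rw [hzr]; exact hr')
    rw [← hzr]
    exact hval z hzΛ' hz
  have hsplit : Splits Qc := IsAlgClosed.splits Qc
  have hroots : Qc.roots = Multiset.replicate Qc.natDegree x₀ := by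
    rw [hsplit.natDegree_eq_card_roots]
    exact Multiset.eq_replicate_card.mpr hall
  have hm : 0 < Qc.natDegree := by
    have hmem : x₀ ∈ Qc.roots := (mem_roots hQc0).mpr hroot
    rw [hsplit.natDegree_eq_card_roots]
    exact Multiset.card_pos.mpr fun h0 ↦ Multiset.notMem_zero x₀ (h0 ▸ hmem)
  have hnext : Qc.nextCoeff = -(Qc.natDegree : ℂ) * x₀ := by
    rw [hsplit.nextCoeff_eq_neg_sum_roots_of_monic hQcm, hroots, Multiset.sum_replicate, nsmul_eq_mul]
    ring
  have hnextQ : Qc.nextCoeff = ((Q₀.nextCoeff : ℚ) : ℂ) := by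
    rw [hQc, nextCoeff_map_eq]; rfl
  have hdeg : Qc.natDegree = Q₀.natDegree := by rw [hQc, natDegree_map]
  refine ⟨-Q₀.nextCoeff / Q₀.natDegree, ?_⟩
  have hm' : (Q₀.natDegree : ℂ) ≠ 0 := by rw [← hdeg]; exact_mod_cast hm.ne'
  push_cast
  rw [← hnextQ, hnext, hdeg]
  field_simp

/-- **Index `3`: the kernel of a rational `3`-isogeny has a rational `x`-coordinate (analytic form).**  If `Λ ⊆ Λ'` has index
`3` — `z₀ ∈ Λ' ∖ Λ` and `Λ' ⊆ Λ ∪ (z₀ + Λ) ∪ (−z₀ + Λ)` — and all four invariants are rational, then `℘_Λ(z₀) ∈ ℚ`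
(`℘_Λ` is even, so it is constant on `Λ' ∖ Λ = ±z₀ + Λ`).  Thus the elliptic curve `y² = 4x³ − g₂x − g₃` over `ℚ` has a
rational root of its `3`-division polynomial: a RATIONAL `3`-isogeny (its kernel points need not be rational).
[cite: SilvermanAEC2009, Thm. VI.4.1 and III.4 (kernel polynomial of a 3-isogeny)] -/
theorem exists_ratCast_eq_weierstrassP_of_index_three (h : L.lattice ≤ L'.lattice)
    (h₂ : ∃ q : ℚ, (q : ℂ) = L.g₂) (h₃ : ∃ q : ℚ, (q : ℂ) = L.g₃)
    (h₂' : ∃ q : ℚ, (q : ℂ) = L'.g₂) (h₃' : ∃ q : ℚ, (q : ℂ) = L'.g₃)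
    {z₀ : ℂ} (hz₀' : z₀ ∈ L'.lattice) (hz₀ : z₀ ∉ L.lattice)
    (hidx : ∀ w ∈ L'.lattice, w ∈ L.lattice ∨ w - z₀ ∈ L.lattice ∨ w + z₀ ∈ L.lattice) :
    ∃ q : ℚ, (q : ℂ) = ℘[L] z₀ := by
  refine L.exists_ratCast_eq_weierstrassP_of_forall_weierstrassP_eq L' h h₂ h₃ h₂' h₃' hz₀' hz₀ fun w hw' hw ↦ ?_
  rcases hidx w hw' with h0 | h0 | h0
  · exact absurd h0 hw
  · have := L.weierstrassP_sub_coe w ⟨w - z₀, h0⟩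
    rw [show w - (w - z₀) = z₀ by ring] at this
    exact this.symm
  · have := L.weierstrassP_sub_coe w ⟨w + z₀, h0⟩
    rw [show w - (w + z₀) = -z₀ by ring, L.weierstrassP_neg] at this
    exact this.symm

/-- A third-period `z₀` (`3z₀ ∈ Λ`) has `℘_Λ(2z₀) = ℘_Λ(z₀)` (`2z₀ ≡ −z₀`): the `3`-division relation in `℘`-form.
[cite: SilvermanAEC2009, III.4 (3-torsion: `[2]T = −T`)] -/
theorem weierstrassP_two_mul_eq_of_three_mul_mem {z₀ : ℂ} (h3 : 3 * z₀ ∈ L.lattice) :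
    ℘[L] (2 * z₀) = ℘[L] z₀ := by
  have := L.weierstrassP_sub_coe (2 * z₀) ⟨3 * z₀, h3⟩
  rw [show 2 * z₀ - 3 * z₀ = -z₀ by ring, L.weierstrassP_neg] at this
  exact this.symm

end PeriodPair

end
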